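import Summits.ABC.IUTFork.Repair.CandJoshi3
import Summits.ABC.IUTFork.Repair.CandJoshi1Profile
import Summits.ABC.IUTFork.Repair.CandJoshi1Tests
import HarnessLib

/-!
# IUT REPAIR branch (rung LADDER-ABC:A2.RP), rows RP-J02a/b — the T-b PROFILE and the T-c census of `LocusCovers` (H_J3) /
# `ShellFilling` (H_J3′), and the chain H_J1 ⟹ H_J3 across the candidate files

PROOF-ONLY record file (D-0012; no definition, no `Prop` fact) of the abc-iut cell, IUT REPAIR branch (seat abc-iut-rp-j1; REPAIR-SPEC v0.2 §3:
«T-b OF RECORD = the PROFILE … (a) CM, (b) the exponent family `expSetting p e`, (c) the log-shell dilates `shellSetting p d` / `rhoOne`, (d) the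
frame flip», «T-c OF RECORD = SAT⁺»). TAKES NO SIDE on [IUTchIII] Cor. 3.12 and on no author; typed ≠ proved; instantiated ≠ endorsed. Companion of
`Repair/CandJoshi3.lean` (p428372: `LocusCovers` = H_J3 «the theta-values locus (union of the possible images) covers the q-pilot region»,
`ShellFilling` = H_J3′ «every hull-set between a Θ-pilot Kummer-image region and the log-shell is a possible image»; K. Joshi, arXiv:2111.04890v2
Thm. 7.8.1 p. 11, Thm. 9.1.1 p. 13, Thm. 10.1.1 p. 16, Prop. 10.2.2 p. 19), in the format of the paired prover's `Repair/CandJoshi1Profile.lean`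
(abc-iut-w4-d098, the profile of record of H_J1/H_J2), whose normal forms and hold-sets it reuses BY NAME.

RESULTS (every prime `p`; standard axioms):
* §1 CHAIN and RIGIDITY. `locusCovers_of_joshiDominance`: under the Θ-pin H_J1 ⟹ H_J3 (any situation). Conversely
  `joshiDominance_of_locusCovers_of_rigid`: where the union of the possible images is the (Ind3)-enlarged region itself (the indeterminacies FIX
  it — every family of record: signs fix balls) and Thm. 3.11 (ii) (b) holds, H_J3 ⟹ H_J1. So on all models of record H_J3 and H_J1 have THE SAME
  hold-set; they differ only where an indeterminacy MOVES the Θ-region (Joshi's reading; none instantiated).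
* §2 LS one-operator family `(shellSetting p d, rhoOne p d, qDatum p)`: `locusCovers_oneRho_iff : H_J3 ↔ 3 ≤ d` (= H_J1's = H_J2's = the `GapH3` set);
  `shellFilling_oneRho_iff : H_J3′ ↔ 4 ≤ d` — for `d ≤ 3` the hull-set `B_0` at label `2` lies between `B_{4−d}` and the shell `B_0` and is no possible
  image; for `d ≥ 4` the dilated Θ-images reach or exceed the shell, «the inflated ball» is at most the one ball `B_0 = B_{4−d}` and the filling holds
  trivially. `shellFilling_forces_not_rfJ2`: wherever H_J3′ holds on the family, RF-J2 of `CandJoshi3` FAILS (else the residual, false on the whole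
  family by abc-iut-rp-m3's `CandMochizuki32.not_S_oneRho`).
* §3 EXP family `(expSetting p e, ballOfMonoid p, qDatumExp p e)`: `locusCovers_exp_iff : H_J3 ↔ (1 ≤ e₁ ∧ 4 ≤ e₂)` (= H_J1's, w4-d098
  `joshiDominance_exp_iff`); H_J3′ is Θ-SIDE ONLY and FAILS on every `withQDatum` setting whatever the q-datum (`not_shellFilling_withQDatum`: at
  label `2`, `B_0` lies between the Θ-image `B_4` and the shell `B_0` and is not the possible image `B_4`) — so at CM-twin P♯, at P♭, at every
  EXP(e), and at `CandJoshi1Tests.stdSetting` (`not_shellFilling_std`).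
* §4 FLIP `(flipSetting p, orbitRegion p, qDatum p)`: `not_locusCovers_flip` although the Licence, `GapH3` and the Statement HOLD at the flip
  (`flip_licence`, `flip_statement`) — the UNION level (H_J3) is STRICTLY STRONGER than the HULL level: the coarse frame's hull inflates `B_4 ∪ ∅`
  to `B_1 ⊇` q-region without any possible image covering it (`flip_separates_union_from_hull`).
* §5 T-c. `std_locusCovers` (grade SAT(rescaled-q): Joshi's standard point of `CandJoshi1Tests`, via the chain); `locusCovers_satPlus` — the packaged
  ∃ at `(naiveFull 2, shellSetting 2 3, rhoOne 2 3, qDatum 2)`: typed Thm. 3.11 ∧ BridgeHyps ∧ AbsLogQPos ∧ PinnedRegions3 ∧ H_J3 ∧ Statement ∧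
  ¬residual (the family REPAIR-SPEC §2 (4) names SAT⁺-eligible; `CandJoshi1Profile.joshi_candidates_satPlus` is the H_J1/H_J2 twin); and for H_J3′ the
  census `shellFilling_census`: FALSE at CM (`CandJoshi3`), at every `withQDatum` setting, at the flip, and on LS for `d ≤ 3`; TRUE on LS only for
  `d ≥ 4`, where the residual fails and RF-J2 fails — its only satisfaction on the models of record is the degenerate one (empty inflated ball).
HONEST SCOPE: toys of the typed interface over `toyIndex` (`l⋇ = 2`); on these families the indeterminacies are the signs, so «dominance/covering»
is realised by INFLATION (`d`) or q-RESCALING (`e`, `stdSetting`), never by a Joshi valuation-rescaling indeterminacy; no judgement on print.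
[claim: Joshi2021ATSII, status: disputed] [claim: Joshi2024ATSIII, status: disputed]
-/

noncomputable section

open Set

namespace Summit.ABC.IUTFork.Repair.CandJoshi3Profile

open Thm311 Cor312 Cor312.Checks Cor312.IdentifiedNonVacuity Cor312Vol Literature.IUT.LogThetaLattice
open Cor312Vol.NaiveWitness Cor312Vol.PinnedWitness Cor312Vol.PinnedHonest
open Summit.ABC.IUTFork.Repair.CandJoshi1 Summit.ABC.IUTFork.Repair.CandJoshi3 Summit.ABC.IUTFork.Repair.CandJoshi1Profile

/-! ## 1. The chain H_J1 ⟹ H_J3, and its converse on rigid families -/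

section Chain

variable {T : ThetaIndex} (S : LatticeSituation T) (P : Cor312.Setting S.toSituation)
  (ρ : (∀ v : T.V, v ∈ T.Vbad → Set (S.L.StarPacket v)) → ∀ (j : T.Label) (vQ : T.VQ), Set (S.L.Packet j vQ))
  (qK : ∀ v : T.V, v ∈ T.Vbad → Set (S.L.StarPacket v))

/-- **H_J1 ⟹ H_J3** under the Θ-pin (`CandJoshi1.JoshiDominance → CandJoshi3.LocusCovers`): with the two files' theorems the full chain reads
residual ⟹ H_J1 ⟹ H_J3 ⟹ hull clause ⟹ Licence ⟹ Statement (the last three under the q-pin / bridge hypotheses). [folklore] -/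
theorem locusCovers_of_joshiDominance (hΘ : ThetaPinned S P ρ) (h : JoshiDominance S P ρ qK) : LocusCovers S P ρ qK :=
  locusCovers_of_dominance S P ρ qK hΘ h

/-- **RIGID converse**: if the indeterminacies do not enlarge the (Ind3)-enlarged Θ-region — the union of the possible images lies in `⋃ₘ Θ-images`
itself — then, under the Θ-pin and Thm. 3.11 (ii) (b) for the column, H_J3 ⟹ H_J1 (with the identity indeterminacy and `m = 0`). On every model of
record the indeterminacies are signs fixing the balls, so there H_J3 and H_J1 coincide. [folklore] -/
theorem joshiDominance_of_locusCovers_of_rigid (hKumB : (S.col P.n).KummerB (S.D P.n)) (hΘ : ThetaPinned S P ρ)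
    (hrigid : ∀ (j : T.Label) (vQ : T.VQ), ⋃₀ P.possibleImages j vQ ⊆ P.thetaRegion3 j vQ) (h : LocusCovers S P ρ qK) :
    JoshiDominance S P ρ qK := fun j vQ => by
  refine ⟨1, Subgroup.one_mem _, 0, ?_⟩
  have h1 : ((1 : S.L.PacketAut) j vQ) '' ρ ((S.col P.n).frobΨ 0) j vQ = ρ ((S.col P.n).frobΨ 0) j vQ := by simp
  have hΨ : (S.col P.n).frobΨ 0 = (S.D P.n).Ψ := funext fun v => funext fun hv => hKumB 0 v hv
  rw [h1, hΨ, ← thetaRegion3_eq_of_thetaPinned S P ρ hKumB hΘ j vQ]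
  exact (h j vQ).trans (hrigid j vQ)

end Chain

/-! ## 2. The log-shell family LS(d), one operator -/

section Shell

variable (p : ℕ) [hp : Fact p.Prime] (d : ℕ)

/-- On the LS family the union of the possible images IS the (Ind3)-enlarged region `B_{j²−d}` (signs fix balls): the family is rigid. [folklore] -/
theorem shell_rigid (j : toyIndex.Label) (vQ : toyIndex.VQ) :
    ⋃₀ (shellSetting p d).possibleImages j vQ ⊆ (shellSetting p d).thetaRegion3 j vQ := by
  rw [shell_possibleImages, Set.sUnion_singleton, shell_thetaRegion3]

/-- **LS one-operator profile of H_J3: `LocusCovers` holds at `(shellSetting p d, rhoOne p d, qDatum p)` IFF `3 ≤ d`** — the same hold-set as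
H_J1/H_J2 (w4-d098 `joshiDominance_oneRho_iff`, `joshiVolumeDominance_shell_iff`) and as `GapH3`/`Licence`. [claim: Joshi2021ATSII, status: disputed] -/
theorem locusCovers_oneRho_iff :
    LocusCovers (naiveFull p).toLatticeSituation (shellSetting p d) (rhoOne p d) (qDatum p) ↔ 3 ≤ d := by
  rw [← joshiDominance_oneRho_iff p d]
  exact ⟨joshiDominance_of_locusCovers_of_rigid _ _ _ _ (GluedMonoids.Naive.naive_kummerB p _) (oneRho_pinnedRegions3 p d).1.1
      (shell_rigid p d),
    locusCovers_of_joshiDominance _ _ _ _ (oneRho_pinnedRegions3 p d).1.1⟩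

omit hp in
/-- The data-(a) log-shell of the naive model at the LS setting's column: `B_0`. [folklore] -/
theorem shell_shellPk (j : toyIndex.Label) (vQ : toyIndex.VQ) :
    ((naiveFull p).D (shellSetting p d).n).shellPk j vQ = pBall p j vQ 0 := rfl

/-- **LS one-operator profile of H_J3′: `ShellFilling` holds at `(shellSetting p d, rhoOne p d)` IFF `4 ≤ d`.** (→) for `d ≤ 3` the hull-set `B_0` at
label `2` contains the Θ-image `B_{4−d}`, lies in the shell `B_0`, and is not the possible image `B_{4−d}`; (←) for `d ≥ 4` a hull-set `B_k` with
`B_{j²−d} ⊆ B_k ⊆ B_0` forces `0 ≤ k ≤ j² − d ≤ 0`, so it IS `B_{j²−d}` — the inflated ball has degenerated. [claim: Joshi2021ATSII, status: disputed] -/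
theorem shellFilling_oneRho_iff :
    ShellFilling (naiveFull p).toLatticeSituation (shellSetting p d) (rhoOne p d) ↔ 4 ≤ d := by
  constructor
  · intro h
    by_contra hd
    have hH : pBall p 2 () 0 ∈ ((shellSetting p d).frame 2 ()).Hul := ⟨0, rfl⟩
    have hlow : ∃ m : ℤ, rhoOne p d (((naiveFull p).toLatticeSituation.col (shellSetting p d).n).frobΨ m) 2 () ⊆ pBall p 2 () 0 :=
      ⟨0, by rw [naiveFull_frobΨ, rhoOne_Psi, shellRegion_Psi, jsq_two]; exact pBall_mono p 2 () (by omega)⟩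
    have hmem := h 2 () _ hH hlow (by rw [shell_shellPk])
    rw [shell_possibleImages, Set.mem_singleton_iff, jsq_two] at hmem
    have := pBall_injective p 2 () hmem
    omega
  · rintro hd j vQ H' ⟨k, rfl⟩ ⟨m, hm⟩ hup
    rw [naiveFull_frobΨ, rhoOne_Psi, shellRegion_Psi] at hm
    rw [shell_shellPk] at hup
    have h1 : k ≤ jsq j - d := (pBall_subset_iff p j vQ _ _).1 hm
    have h2 : (0 : ℤ) ≤ k := (pBall_subset_iff p j vQ _ _).1 hup
    have h4 := jsq_le_four j
    rw [shell_possibleImages, Set.mem_singleton_iff, show k = jsq j - d by omega]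

omit hp in
/-- RF-J1 of `CandJoshi3` («q-region ⊆ log-shell») HOLDS on the whole family (the q-side is `pinnedSetting`'s: `B_1 ⊆ B_0`). [folklore] -/
theorem rfJ1_shell (j : toyIndex.Label) (vQ : toyIndex.VQ) :
    (shellSetting p d).qRegion j vQ ⊆ ((naiveFull p).D (shellSetting p d).n).shellPk j vQ := by
  rw [shell_qRegion_eq]; exact rfJ1_pinnedSetting p j vQ

/-- **Wherever H_J3′ holds on the family, RF-J2 («some Θ-image ⊆ q-region») FAILS** — else `CandJoshi3.pilotKummerIndRelated_of_shellFilling` would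
give the residual, false on the whole family (`CandMochizuki32.not_S_oneRho`). So the level-R route of RP-J02b never fires on LS. [folklore] -/
theorem shellFilling_forces_not_rfJ2 (h : ShellFilling (naiveFull p).toLatticeSituation (shellSetting p d) (rhoOne p d)) :
    ¬ ∀ (j : toyIndex.Label) (vQ : toyIndex.VQ), ∃ m : ℤ, (shellSetting p d).thetaRegion m j vQ ⊆ (shellSetting p d).qRegion j vQ :=
  fun hrf2 => CandMochizuki32.not_S_oneRho p d
    (pilotKummerIndRelated_of_shellFilling _ _ _ _ (GluedMonoids.Naive.naive_kummerB p _) (oneRho_pinnedRegions3 p d).1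
      (rfJ1_shell p d) hrf2 h)

/-- LS regimes for RP-J02 (complementing w4-d098's `ls_regimes` for RP-J01): `d = 2` — Statement TRUE, H_J3 and H_J3′ FALSE (the covering is
sufficient, not necessary); `d = 3` — H_J3 TRUE, H_J3′ FALSE, Statement TRUE, residual FALSE; `d = 4` — H_J3′ TRUE (degenerate), residual FALSE.
[folklore] -/
theorem ls_regimes_J02 :
    ((shellSetting p 2).Statement ∧
        ¬ LocusCovers (naiveFull p).toLatticeSituation (shellSetting p 2) (rhoOne p 2) (qDatum p) ∧
        ¬ ShellFilling (naiveFull p).toLatticeSituation (shellSetting p 2) (rhoOne p 2)) ∧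
      (LocusCovers (naiveFull p).toLatticeSituation (shellSetting p 3) (rhoOne p 3) (qDatum p) ∧
        ¬ ShellFilling (naiveFull p).toLatticeSituation (shellSetting p 3) (rhoOne p 3) ∧
        (shellSetting p 3).Statement ∧
        ¬ PilotKummerIndRelated (naiveFull p).toLatticeSituation (shellSetting p 3) (rhoOne p 3) (qDatum p)) ∧
      (ShellFilling (naiveFull p).toLatticeSituation (shellSetting p 4) (rhoOne p 4) ∧
        ¬ PilotKummerIndRelated (naiveFull p).toLatticeSituation (shellSetting p 4) (rhoOne p 4) (qDatum p)) := by
  refine ⟨⟨(shell_statement_iff p 2).2 (by norm_num), fun h => ?_, fun h => ?_⟩,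
    ⟨(locusCovers_oneRho_iff p 3).2 le_rfl, fun h => ?_, (shell_statement_iff p 3).2 (by norm_num), CandMochizuki32.not_S_oneRho p 3⟩,
    ⟨(shellFilling_oneRho_iff p 4).2 le_rfl, CandMochizuki32.not_S_oneRho p 4⟩⟩
  · have := (locusCovers_oneRho_iff p 2).1 h; omega
  · have := (shellFilling_oneRho_iff p 2).1 h; omega
  · have := (shellFilling_oneRho_iff p 3).1 h; omega

end Shell

/-! ## 3. The exponent family EXP(e) and every `withQDatum` setting -/

section Exp

variable (p : ℕ) [hp : Fact p.Prime] (e : toyIndex.LabelStar → ℕ)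

omit hp in
/-- Every `withQDatum` setting is rigid: the union of the possible images is the (Ind3)-enlarged region `B_{j²}`. [folklore] -/
theorem withQDatum_rigid (qK : ∀ v : toyIndex.V, v ∈ toyIndex.Vbad → Set (signShells.StarPacket v))
    (hqK : ∀ (j : toyIndex.Label) (vQ : toyIndex.VQ), ∃ k : ℤ, pBall p j vQ k = GluedMonoids.Naive.ballOfMonoid p qK j vQ)
    (j : toyIndex.Label) (vQ : toyIndex.VQ) :
    ⋃₀ (withQDatum p qK hqK).possibleImages j vQ ⊆ (withQDatum p qK hqK).thetaRegion3 j vQ := by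
  rw [withQDatum_sUnion_possibleImages, withQDatum_thetaRegion3]

/-- On every `withQDatum` setting (operator `ballOfMonoid`, any datum), H_J3 ⟺ H_J1. [folklore] -/
theorem locusCovers_iff_joshiDominance_withQDatum (qK : ∀ v : toyIndex.V, v ∈ toyIndex.Vbad → Set (signShells.StarPacket v))
    (hqK : ∀ (j : toyIndex.Label) (vQ : toyIndex.VQ), ∃ k : ℤ, pBall p j vQ k = GluedMonoids.Naive.ballOfMonoid p qK j vQ) :
    LocusCovers (naiveFull p).toLatticeSituation (withQDatum p qK hqK) (GluedMonoids.Naive.ballOfMonoid p) qK ↔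
      JoshiDominance (naiveFull p).toLatticeSituation (withQDatum p qK hqK) (GluedMonoids.Naive.ballOfMonoid p) qK :=
  ⟨joshiDominance_of_locusCovers_of_rigid _ _ _ _ (GluedMonoids.Naive.naive_kummerB p _) (withQDatum_thetaPinned p qK hqK)
      (withQDatum_rigid p qK hqK),
    locusCovers_of_joshiDominance _ _ _ _ (withQDatum_thetaPinned p qK hqK)⟩

/-- **EXP profile of H_J3: `LocusCovers` holds at `(expSetting p e, ballOfMonoid p, qDatumExp p e)` IFF `e_j ≥ j²` at both labels** — the hold-set
of H_J1 (w4-d098 `joshiDominance_exp_iff`), strictly between the residual's `{e = (1,4)}` and the Statement's `{5 ≤ e₁ + e₂}`.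
[claim: Joshi2021ATSII, status: disputed] -/
theorem locusCovers_exp_iff :
    LocusCovers (naiveFull p).toLatticeSituation (expSetting p e) (GluedMonoids.Naive.ballOfMonoid p) (fun v _ => qDatumExp p e v) ↔
      (1 ≤ e ⟨1, by decide⟩ ∧ 4 ≤ e ⟨2, by decide⟩) := by
  rw [← joshiDominance_exp_iff p e]
  exact locusCovers_iff_joshiDominance_withQDatum p _ _

/-- **H_J3′ is Θ-SIDE ONLY and FAILS on EVERY `withQDatum` setting** (operator `ballOfMonoid`, any q-datum): at label `2` the hull-set `B_0` lies
between the Θ-image `B_4` and the shell `B_0` and is not the possible image `B_4`. Hence false at P♯, P♭, every EXP(e), and the standard-point model.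
[claim: Joshi2021ATSII, status: disputed] -/
theorem not_shellFilling_withQDatum (qK : ∀ v : toyIndex.V, v ∈ toyIndex.Vbad → Set (signShells.StarPacket v))
    (hqK : ∀ (j : toyIndex.Label) (vQ : toyIndex.VQ), ∃ k : ℤ, pBall p j vQ k = GluedMonoids.Naive.ballOfMonoid p qK j vQ) :
    ¬ ShellFilling (naiveFull p).toLatticeSituation (withQDatum p qK hqK) (GluedMonoids.Naive.ballOfMonoid p) := by
  intro h
  have hH : pBall p 2 () 0 ∈ ((withQDatum p qK hqK).frame 2 ()).Hul := ⟨0, rfl⟩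
  have hlow : ∃ m : ℤ, GluedMonoids.Naive.ballOfMonoid p (((naiveFull p).toLatticeSituation.col (withQDatum p qK hqK).n).frobΨ m) 2 () ⊆
      pBall p 2 () 0 :=
    ⟨0, by rw [naiveFull_frobΨ, GluedMonoids.Naive.ballOfMonoid_psi, jsq_two]; exact pBall_mono p 2 () (by norm_num)⟩
  have hup : pBall p 2 () 0 ⊆ ((naiveFull p).D (withQDatum p qK hqK).n).shellPk 2 () := subset_rfl
  have hmem := h 2 () _ hH hlow hup
  rw [withQDatum_possibleImages, Set.mem_singleton_iff, jsq_two] at hmem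
  have := pBall_injective p 2 () hmem
  omega

/-- H_J3′ fails at every EXP(e). [folklore] -/
theorem not_shellFilling_exp :
    ¬ ShellFilling (naiveFull p).toLatticeSituation (expSetting p e) (GluedMonoids.Naive.ballOfMonoid p) :=
  not_shellFilling_withQDatum p _ _

/-- H_J3′ fails at Joshi's standard-point model of `CandJoshi1Tests` (a `withQDatum` setting). [folklore] -/
theorem not_shellFilling_std :
    ¬ ShellFilling (naiveFull p).toLatticeSituation (stdSetting p) (GluedMonoids.Naive.ballOfMonoid p) :=
  not_shellFilling_withQDatum p _ _

/-- **H_J3 HOLDS at the standard-point model** (grade SAT(rescaled-q): from `CandJoshi1Tests.std_joshiDominance` by the chain). [folklore] -/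
theorem std_locusCovers :
    LocusCovers (naiveFull p).toLatticeSituation (stdSetting p) (GluedMonoids.Naive.ballOfMonoid p) fun v _ => stdQDatum p v :=
  locusCovers_of_joshiDominance _ _ _ _ (std_pinnedRegions3 p).1.1 (std_joshiDominance p)

end Exp

/-! ## 4. The frame flip separates the UNION level from the HULL level -/

section Flip

variable (p : ℕ) [hp : Fact p.Prime]

/-- **FLIP: H_J3 FAILS at `flipSetting p`** (the union of the possible images at label `2` is `B_4 ⊉ B_1`) … [folklore] -/
theorem not_locusCovers_flip :
    ¬ LocusCovers (naiveFull p).toLatticeSituation (flipSetting p) (orbitRegion p) (qDatum p) := by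
  intro h
  have h2 := h 2 ()
  rw [flip_sUnion_possibleImages, orbitRegion_qDatum p (by decide), pBall_subset_iff, jsq_two] at h2
  omega

/-- … while the Licence, `GapH3` and the typed Statement HOLD there (abc-iut-w4-d048): **the union level is STRICTLY STRONGER than the hull
level** — a coarse frame inflates the hull over the q-region with no possible image covering it. [folklore] -/
theorem flip_separates_union_from_hull :
    Thm311ToCor312.Licence (flipSetting p) ∧ GapH3 (naiveFull p).toLatticeSituation (flipSetting p) (orbitRegion p) (qDatum p) ∧
      (flipSetting p).Statement ∧ ¬ LocusCovers (naiveFull p).toLatticeSituation (flipSetting p) (orbitRegion p) (qDatum p) :=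
  ⟨flip_licence p, flip_gapH3 p, flip_statement p, not_locusCovers_flip p⟩

end Flip

/-! ## 5. T-c packages and the H_J3′ census -/

section Packages

variable (p : ℕ) [hp : Fact p.Prime]

/-- **(T-c for RP-J02a) packaged ∃ at `p = 2`, `d = 3`** (REPAIR-SPEC §2 (4) shape; the family named SAT⁺-eligible there): typed Thm. 3.11 ∧
BridgeHyps ∧ `|log(q)| > 0` ∧ PinnedRegions3 (one equivariant operator, computed q-datum) ∧ H_J3 ∧ the typed Statement ∧ NOT the residual.
[claim: Joshi2021ATSII, status: disputed] -/
theorem locusCovers_satPlus :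
    ∃ (T : ThetaIndex) (F : FullSituation T) (P : Cor312.Setting F.toLatticeSituation.toSituation)
      (ρ : (∀ v : T.V, v ∈ T.Vbad → Set (F.L.StarPacket v)) → ∀ (j : T.Label) (vQ : T.VQ), Set (F.L.Packet j vQ))
      (qK : ∀ v : T.V, v ∈ T.Vbad → Set (F.L.StarPacket v)),
      F.Statement ∧ BridgeHyps P ∧ P.AbsLogQPos ∧ PinnedRegions3 F.toLatticeSituation P ρ qK ∧
      LocusCovers F.toLatticeSituation P ρ qK ∧ P.Statement ∧ ¬ PilotKummerIndRelated F.toLatticeSituation P ρ qK := by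
  haveI : Fact (Nat.Prime 2) := ⟨Nat.prime_two⟩
  exact ⟨toyIndex, naiveFull 2, shellSetting 2 3, rhoOne 2 3, qDatum 2, naiveFull_statement 2, shell_bridgeHyps 2 3,
    shell_absLogQPos 2 3, oneRho_pinnedRegions3 2 3, (locusCovers_oneRho_iff 2 3).2 le_rfl, (shell_statement_iff 2 3).2 (by norm_num),
    CandMochizuki32.not_S_oneRho 2 3⟩

/-- **THE H_J3′ CENSUS on the models of record**: the filling claim FAILS at the pinned countermodel, at every `withQDatum` setting (P♯, P♭, EXP,
standard point), at the flip-free LS settings with `d ≤ 3`; it HOLDS on LS exactly for `d ≥ 4`, where the residual FAILS and RF-J2 FAILS — its only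
satisfaction is the degenerate one (the inflated ball has collapsed to a single ball or is empty). [claim: Joshi2021ATSII, status: disputed] -/
theorem shellFilling_census :
    ¬ ShellFilling (naiveFull p).toLatticeSituation (pinnedSetting p) (orbitRegion p) ∧
      (∀ (qK : ∀ v : toyIndex.V, v ∈ toyIndex.Vbad → Set (signShells.StarPacket v))
        (hqK : ∀ (j : toyIndex.Label) (vQ : toyIndex.VQ), ∃ k : ℤ, pBall p j vQ k = GluedMonoids.Naive.ballOfMonoid p qK j vQ),
        ¬ ShellFilling (naiveFull p).toLatticeSituation (withQDatum p qK hqK) (GluedMonoids.Naive.ballOfMonoid p)) ∧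
      (∀ d : ℕ, ShellFilling (naiveFull p).toLatticeSituation (shellSetting p d) (rhoOne p d) ↔ 4 ≤ d) ∧
      (∀ d : ℕ, ShellFilling (naiveFull p).toLatticeSituation (shellSetting p d) (rhoOne p d) →
        ¬ PilotKummerIndRelated (naiveFull p).toLatticeSituation (shellSetting p d) (rhoOne p d) (qDatum p) ∧
        ¬ ∀ (j : toyIndex.Label) (vQ : toyIndex.VQ), ∃ m : ℤ, (shellSetting p d).thetaRegion m j vQ ⊆ (shellSetting p d).qRegion j vQ) :=
  ⟨not_shellFilling_pinnedSetting p, fun qK hqK => not_shellFilling_withQDatum p qK hqK, fun d => shellFilling_oneRho_iff p d,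
    fun d h => ⟨CandMochizuki32.not_S_oneRho p d, shellFilling_forces_not_rfJ2 p d h⟩⟩

end Packages

end Summit.ABC.IUTFork.Repair.CandJoshi3Profile

end
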